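import Literature.Analysis.FluidPDE.ElgindiWkWords
import HarnessLib

/-!
# Stirling expansion of the scaling derivatives: `D_z^b = Σ_m S(b,m) z^m ∂_z^m` on the open strip
([ElgindiGhoulMasmoudi2021] §1.7 / §9 Proposition 9.3: converting `D_z`-words into the `(z+1)^k∂_z^k` terms of the `𝓦^{l,∞}` norm)

Topic `Literature/Analysis/FluidPDE`. Support file (definitions with bodies and proved theorems, no
named facts) on the proof path of the named fact
`Literature.Analysis.FluidPDE.Elgindi.ElgindiGhoulMasmoudi2021_stabilityCore`
(`ElgindiStabilityDecomposition.lean`). T. M. Elgindi, T.-E. Ghoul, N. Masmoudi, Camb. J. Math. 9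
(2021) = arXiv:1910.14071, §1.7 (p. 6, the `𝓦^{l,∞}` norm with `(z+1)^k∂_z^k`) and §9
Proposition 9.3 (p. 20).

`D_z = z∂_z` iterates as `D_z^b f = Σ_{m=0}^{b} S(b,m)·z^m·∂_z^m f` with the Stirling numbers of the
second kind `S(b,m)` (`stir`, `S(b+1,m+1) = (m+1)S(b,m+1) + S(b,m)`), pointwise on the open strip for
`f` smooth there (`iterate_Dz_eq_sum_stirling`), and `S(b,m) ≤ (b+1)^b`, `z^m ≤ (z+1)^m`.
-/

noncomputable section

open MeasureTheory Set Function Real Filter Finset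
open _root_.Topology
open scoped ENNReal ContDiff

namespace Literature.Analysis.FluidPDE

namespace Elgindi

/-- The Stirling numbers of the second kind `S(b, m)`: `S(0,0) = 1`, `S(b+1, m+1) = (m+1)S(b, m+1) + S(b, m)`. [folklore] -/
def stir : ℕ → ℕ → ℕ
  | 0, 0 => 1
  | 0, _ + 1 => 0
  | _ + 1, 0 => 0
  | b + 1, m + 1 => (m + 1) * stir b (m + 1) + stir b m

/-- `S(0,0) = 1`. [folklore] -/
@[simp] theorem stir_zero_zero : stir 0 0 = 1 := rfl

/-- `S(0,m+1) = 0`. [folklore] -/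
@[simp] theorem stir_zero_succ (m : ℕ) : stir 0 (m + 1) = 0 := rfl

/-- `S(b+1,0) = 0`. [folklore] -/
@[simp] theorem stir_succ_zero (b : ℕ) : stir (b + 1) 0 = 0 := rfl

/-- The recursion `S(b+1,m+1) = (m+1)S(b,m+1) + S(b,m)`. [folklore] -/
theorem stir_succ_succ (b m : ℕ) : stir (b + 1) (m + 1) = (m + 1) * stir b (m + 1) + stir b m := rfl

/-- `S(b, m) = 0` for `m > b`. [folklore] -/
theorem stir_eq_zero_of_lt {b m : ℕ} (h : b < m) : stir b m = 0 := by
  induction b generalizing m with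
  | zero => obtain ⟨m', rfl⟩ : ∃ m', m = m' + 1 := ⟨m - 1, by omega⟩; rfl
  | succ b ih =>
    obtain ⟨m', rfl⟩ : ∃ m', m = m' + 1 := ⟨m - 1, by omega⟩
    rw [stir_succ_succ, ih (by omega), ih (by omega)]; ring

/-- The crude bound `S(b, m) ≤ (b+1)^b`. [folklore] -/
theorem stir_le (b m : ℕ) : stir b m ≤ (b + 1) ^ b := by
  induction b generalizing m with
  | zero => cases m <;> simp
  | succ b ih =>
    cases m with
    | zero => simp
    | succ m =>
      rw [stir_succ_succ]
      by_cases hm : b < m + 1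
      · rw [stir_eq_zero_of_lt hm, mul_zero, zero_add]
        exact (ih m).trans (Nat.pow_le_pow_left (by omega) b |>.trans (Nat.pow_le_pow_right (by omega) (by omega)))
      · have h1 := ih (m + 1)
        have h2 := ih m
        have hm' : m + 1 ≤ b := by omega
        calc (m + 1) * stir b (m + 1) + stir b m ≤ b * (b + 1) ^ b + (b + 1) ^ b := by
              gcongr
          _ = (b + 1) ^ (b + 1) := by ring
          _ ≤ (b + 1 + 1) ^ (b + 1) := Nat.pow_le_pow_left (by omega) _

/-! ### Calculus of the summands on the strip -/

/-- The summand `S·z^m·∂_z^m f` is smooth on the strip. [folklore] -/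
theorem contDiffOn_stirTerm {f : ℝ → ℝ → ℝ} (hf : ContDiffOn ℝ ∞ (uncurry f) strip) (c : ℝ) (m : ℕ) :
    ContDiffOn ℝ ∞ (uncurry fun z θ => c * z ^ m * (dz^[m] f) z θ) strip := by
  have h1 : ContDiffOn ℝ ∞ (fun p : ℝ × ℝ => c * p.1 ^ m) strip := by fun_prop
  exact (h1.mul (contDiffOn_iterate_dz_strip hf m)).congr fun _ _ => rfl

/-- `∂_z(c z^m g) = c(m z^{m−1} g + z^m ∂_z g)` on the strip, written with `z·(…)`:
`z ∂_z(c z^m g) = c(m z^m g + z^{m+1} ∂_z g)`. [folklore] -/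
theorem Dz_stirTerm {g : ℝ → ℝ → ℝ} (hg : ContDiffOn ℝ ∞ (uncurry g) strip) (c : ℝ) (m : ℕ) {p : ℝ × ℝ} (hp : p ∈ strip) :
    Dz (fun z θ => c * z ^ m * g z θ) p.1 p.2 = c * (m * p.1 ^ m * g p.1 p.2 + p.1 ^ (m + 1) * dz g p.1 p.2) := by
  have hg1 : ContDiffOn ℝ 1 (uncurry g) strip := hg.of_le (by exact_mod_cast le_top)
  have hgd : HasDerivAt (fun z => g z p.2) (dz g p.1 p.2) p.1 := hasDerivAt_slice_fst_dz hg1 hp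
  have hpow : HasDerivAt (fun z : ℝ => c * z ^ m) (c * (m * p.1 ^ (m - 1))) p.1 := by
    simpa using ((hasDerivAt_pow m p.1).const_mul c)
  have hprod : HasDerivAt (fun z => c * z ^ m * g z p.2) (c * (↑m * p.1 ^ (m - 1)) * g p.1 p.2 + c * p.1 ^ m * dz g p.1 p.2) p.1 :=
    hpow.mul hgd
  rw [Dz_eq_mul_dz]
  show p.1 * deriv (fun z => c * z ^ m * g z p.2) p.1 = _
  rw [hprod.deriv]
  rcases Nat.eq_zero_or_pos m with hm | hm
  · subst hm; simp; ring
  · have e : p.1 * p.1 ^ (m - 1) = p.1 ^ m := by rw [← pow_succ']; congr 1; omega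
    calc p.1 * (c * (↑m * p.1 ^ (m - 1)) * g p.1 p.2 + c * p.1 ^ m * dz g p.1 p.2)
        = c * (↑m * (p.1 * p.1 ^ (m - 1)) * g p.1 p.2 + p.1 * p.1 ^ m * dz g p.1 p.2) := by ring
      _ = _ := by rw [e, ← pow_succ']

/-- `D_z` of a finite sum of strip-smooth functions, on the strip. [folklore] -/
theorem Dz_finsetSum_strip {ι : Type*} (s : Finset ι) {F : ι → ℝ → ℝ → ℝ} (hF : ∀ i ∈ s, ContDiffOn ℝ ∞ (uncurry (F i)) strip)
    {p : ℝ × ℝ} (hp : p ∈ strip) :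
    Dz (fun z θ => ∑ i ∈ s, F i z θ) p.1 p.2 = ∑ i ∈ s, Dz (F i) p.1 p.2 := by
  have hd : ∀ i ∈ s, HasDerivAt (fun z => F i z p.2) (dz (F i) p.1 p.2) p.1 := fun i hi =>
    hasDerivAt_slice_fst_dz ((hF i hi).of_le (by exact_mod_cast le_top)) hp
  have hsum : HasDerivAt (fun z => ∑ i ∈ s, F i z p.2) (∑ i ∈ s, dz (F i) p.1 p.2) p.1 := by
    have h := HasDerivAt.sum hd
    have e : (∑ i ∈ s, fun z => F i z p.2) = fun z => ∑ i ∈ s, F i z p.2 := by funext z; simp [Finset.sum_apply]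
    rwa [e] at h
  rw [Dz_eq_mul_dz]
  show p.1 * deriv (fun z => ∑ i ∈ s, F i z p.2) p.1 = _
  rw [hsum.deriv, mul_sum]
  refine sum_congr rfl fun i _ => ?_
  rw [Dz_eq_mul_dz]

/-! ### The expansion -/

/-- **`D_z^b f = Σ_{m ≤ b} S(b,m)·z^m·∂_z^m f`** pointwise on the open strip, for `f` smooth there. [cite: ElgindiGhoulMasmoudi2021, §1.7 (p. 6 of arXiv:1910.14071)] -/
theorem iterate_Dz_eq_sum_stirling {f : ℝ → ℝ → ℝ} (hf : ContDiffOn ℝ ∞ (uncurry f) strip) (b : ℕ) :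
    ∀ p ∈ strip, (Dz^[b] f) p.1 p.2 = ∑ m ∈ range (b + 1), (stir b m : ℝ) * p.1 ^ m * (dz^[m] f) p.1 p.2 := by
  induction b with
  | zero => intro p _; simp
  | succ b ih =>
    intro p hp
    rw [Function.iterate_succ_apply']
    -- `D_z` of the expansion of `D_z^b f` (the two functions agree on the strip)
    have hterms : ∀ m ∈ range (b + 1), ContDiffOn ℝ ∞ (uncurry fun z θ => (stir b m : ℝ) * z ^ m * (dz^[m] f) z θ) strip :=
      fun m _ => contDiffOn_stirTerm hf _ m
    have hcongr : Dz (Dz^[b] f) p.1 p.2 = Dz (fun z θ => ∑ m ∈ range (b + 1), (stir b m : ℝ) * z ^ m * (dz^[m] f) z θ) p.1 p.2 := by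
      have h0 := iterate_Dθ_Dz_congr (f := Dz^[b] f) (g := fun z θ => ∑ m ∈ range (b + 1), (stir b m : ℝ) * z ^ m * (dz^[m] f) z θ)
        (fun q hq => ih q hq) 0 1 p hp
      simpa using h0
    rw [hcongr, Dz_finsetSum_strip _ hterms hp]
    simp_rw [Dz_stirTerm (contDiffOn_iterate_dz_strip hf _) _ _ hp]
    -- reindex: `Σ_m S(b,m)(m z^m ∂^m f + z^{m+1} ∂^{m+1} f) = Σ_m S(b+1,m) z^m ∂^m f`
    simp_rw [mul_add, sum_add_distrib]
    have e2 : ∑ m ∈ range (b + 1), (stir b m : ℝ) * (p.1 ^ (m + 1) * dz (dz^[m] f) p.1 p.2) =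
        ∑ m ∈ range (b + 2), (if m = 0 then 0 else (stir b (m - 1) : ℝ)) * p.1 ^ m * (dz^[m] f) p.1 p.2 := by
      rw [sum_range_succ' _ (b + 1)]
      simp only [if_true, zero_mul, add_zero]
      refine sum_congr rfl fun m _ => ?_
      rw [if_neg (by omega), Nat.add_sub_cancel, ← Function.iterate_succ_apply' dz m f]; ring
    have e1 : ∑ m ∈ range (b + 1), (stir b m : ℝ) * (↑m * p.1 ^ m * (dz^[m] f) p.1 p.2) =
        ∑ m ∈ range (b + 2), (m * stir b m : ℝ) * p.1 ^ m * (dz^[m] f) p.1 p.2 := by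
      rw [sum_range_succ _ (b + 1), stir_eq_zero_of_lt (Nat.lt_succ_self b)]
      simp only [Nat.cast_zero, mul_zero, zero_mul, add_zero]
      exact sum_congr rfl fun m _ => by ring
    rw [e1, e2, ← sum_add_distrib]
    refine sum_congr rfl fun m _ => ?_
    rcases Nat.eq_zero_or_pos m with hm | hm
    · subst hm; simp
    · obtain ⟨m', rfl⟩ : ∃ m', m = m' + 1 := ⟨m - 1, by omega⟩
      rw [if_neg (by omega), Nat.add_sub_cancel, stir_succ_succ]; push_cast; ring

/-- `0 ≤ z^m ≤ (z+1)^m` for `z > 0`. [folklore] -/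
theorem pow_le_add_one_pow {z : ℝ} (hz : 0 < z) (m : ℕ) : z ^ m ≤ (z + 1) ^ m :=
  pow_le_pow_left₀ hz.le (by linarith) m

end Elgindi

end Literature.Analysis.FluidPDE
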